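import Summits.Ventures.HSemireg.EmbeddedFirstOrderDeformationsCechObstruction

/-!
# Venture HSemireg — NATURALITY of the Čech obstruction: morphisms of thickened atlases (refinements, chart maps,
# change of overlap trivialisations) transport lifts of `Z`, the Čech cochain and its coboundaries
# (Hartshorne, *Deformation Theory*, proof of Thm. 6.2 (b): «the cohomology class is well-defined»)

HONEST FRAMING.  Lean side of the computation cell `pub-hsemireg` (track «S4-PUSH» (ii), seat s4-prove-3 g6, second
route for (S5)); log `s4push/prove-3/ATTEMPT-10.md` (file VI of the ATTEMPT-9 package; s4-ref g34 P-1/P-2 folded).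
Plain commutative algebra over ABSTRACT THICKENED ATLASES (`…CechObstruction`); no Mathlib scheme, sheaf,
Čech-to-derived comparison, abelian variety or semiregularity map is constructed; nothing here says that HC, HC_CM
or HC_AV holds; no object is certified; no Literature fact is declared.

WHAT (namespace `Summit.Ventures.HSemireg.EmbeddedDeformation`).  `…CechObstruction` proves Thm. 6.2 (b) for ONE
thickened atlas `𝔄` with chosen local lifts `T_α`.  Here:
* §1 `resNormal_comp` — restriction of normal vectors along a composite of lift-preserving morphisms of thickenings
  is the composite of the restrictions (`(φ|_{S'})|_{S''} = φ|_{S''}`), and `resNormal_congr_hom` (bookkeeping);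
  `isThickeningHom_id` / `preservesLifts_id`.
* §2 `ThickenedAtlasHom 𝔄 𝔅 g g₂` — a MORPHISM OF THICKENED ATLASES (same index set): lift-preserving morphisms of
  thickenings on charts `g_α : A'_α → B'_α` and on overlaps `g_αβ : A'_αβ → B'_αβ` commuting with the restrictions.
  Instances: a refinement `V_α ⊆ U_{f α}` (after `ThickenedAtlas.reindex f`, §3), the chart-wise localisation maps, a
  change of the overlap trivialisations by automorphisms `ψ_αβ` (§4).  THEOREMS: `IsAtlasLift.map` (a lift of `Z` to
  `𝔄` pushes to a lift of `Z` to `𝔅`), **`cechCochain_map`** (the Čech cochain of the pushed local choices is the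
  restriction of the Čech cochain: `c^𝔅_αβ = (c^𝔄_αβ)|`), `resL_map` / `resR_map` (restriction to overlaps commutes
  with the chart maps), **`coboundary_map`** (a coboundary presentation pushes forward — the obstruction CLASS is
  natural), `exists_isAtlasLift_map` / `exists_isAtlasLift_iff_of_hom` (liftability is transported; with morphisms
  both ways it is EQUIVALENT).
* §3 `ThickenedAtlas.reindex` / `IsAtlasLift.reindex` — pulling an atlas back along an index map (the first half of
  «refinement»: coarse-liftable ⇒ fine-liftable is then `exists_isAtlasLift_map`).
* §4 `thickenedAtlas_overlapEquiv` / **`isAtlasLift_overlapEquiv_iff`** — composing BOTH restrictions of every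
  overlap with the SAME automorphism `ψ_αβ` of the overlap thickening (over the base, fixing the parameter) gives
  again a thickened atlas with LITERALLY THE SAME lifts of `Z`: the obstruction does not see a re-coordinatisation
  of the overlap thickening.  (A twist on ONE restriction only — the gluing datum `θ_αβ` of `…TwistedAtlas` — is a
  different atlas and is NOT covered by this lemma.)
NOT typed here: the converse half of refinement invariance (gluing fine lifts back to the coarse charts is
`…LiftGluing` chart by chart plus uniqueness on overlaps), Čech-vs-sheaf `H¹`, Mathlib schemes.

References: R. Hartshorne, *Deformation Theory*, GTM 257 (2010), §6 proof of Thm. 6.2 (b) [corpus: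
book:springernd-deformation-theory p0056 («so the cohomology class is well-defined»; naturality of the `α_ij`)].
-/

namespace Summit.Ventures.HSemireg

namespace EmbeddedDeformation

universe w w' u v u' v' u'' v'' u₃ v₃ u₄ v₄

/-! ### §1 Restriction of normal vectors along a composite; identities -/

section Comp

variable {R' : Type u} {R : Type v} {S' : Type u'} {S : Type v'} {S'' : Type u''} {Q : Type v''}
variable [CommRing R'] [CommRing R] [CommRing S'] [CommRing S] [CommRing S''] [CommRing Q]
variable {π : R' →+* R} {e : R'} {τ : S' →+* S} {e' : S'} {τ'' : S'' →+* Q} {e'' : S''}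
variable {hT : IsFirstOrderThickening π e} {hT' : IsFirstOrderThickening τ e'} {hT'' : IsFirstOrderThickening τ'' e''}
variable {ρ : R' →+* S'} {r : R →+* S} {ρ' : S' →+* S''} {r' : S →+* Q}
variable {I : Ideal R} {I' : Ideal S} {I'' : Ideal Q} {K₀ : Ideal R'}

/-- The identity is a morphism of thickenings. [folklore] -/
theorem isThickeningHom_id (π : R' →+* R) (e : R') : IsThickeningHom π e π e (RingHom.id R') (RingHom.id R) :=
  ⟨fun _ ↦ rfl, rfl⟩

/-- The identity preserves flat lifts. [folklore] -/
theorem preservesLifts_id (π : R' →+* R) (e : R') (I : Ideal R) : PreservesLifts π e π e (RingHom.id R') I I :=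
  fun K hK ↦ by rwa [Ideal.map_id]

/-- Bookkeeping: the restriction of normal vectors along `ρ` only depends on the ring map `ρ` (equal maps, any two
lift-preservation witnesses). [folklore] -/
theorem resNormal_congr_hom {ρ₁ ρ₂ : R' →+* S'} (h : ρ₁ = ρ₂) (hP₁ : PreservesLifts π e τ e' ρ₁ I I')
    (hP₂ : PreservesLifts π e τ e' ρ₂ I I') (h₀ : IsLift π e I K₀) (φ : I →ₗ[R] R ⧸ I) :
    resNormal hT hT' hP₁ h₀ φ = resNormal hT hT' hP₂ h₀ φ := by
  subst h
  rfl

/-- **Restriction along a composite is the composite of the restrictions**: for lift-preserving morphisms of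
thickenings `ρ : R' → S'` over `r` and `ρ' : S' → S''` over `r'`, `φ|_{S''} = (φ|_{S'})|_{S''}` in
`Hom(I'', Q/I'')` (both are pinned by `ψ(r' r x) = r' r (φ x)`; Hartshorne: the `α_ij` and the action are natural,
so they restrict consistently to triple overlaps and to refinements). [cite: Hartshorne2010, §6 proof of Thm. 6.2] -/
theorem resNormal_comp (hρ : IsThickeningHom π e τ e' ρ r) (hρ' : IsThickeningHom τ e' τ'' e'' ρ' r')
    (hP : PreservesLifts π e τ e' ρ I I') (hP' : PreservesLifts τ e' τ'' e'' ρ' I' I'') (h₀ : IsLift π e I K₀)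
    (φ : I →ₗ[R] R ⧸ I) :
    resNormal hT hT'' (hP.comp hP') h₀ φ = resNormal hT' hT'' hP' (hP h₀) (resNormal hT hT' hP h₀ φ) := by
  refine (eq_resNormal (hρ.comp hρ') (hP.comp hP') h₀ φ fun x y hy hx ↦ ?_).symm
  have hrx : r x ∈ I' := by
    rw [← hP.map_eq hρ h₀]
    exact Ideal.mem_map_of_mem r x.2
  exact resNormal_apply hρ' hP' (hP h₀) (resNormal hT hT' hP h₀ φ) ⟨r x, hrx⟩ (r y)
    (resNormal_apply hρ hP h₀ φ x y hy hrx).symm hx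

end Comp

/-! ### §2 Morphisms of thickened atlases; lifts, the cochain and coboundaries push forward -/

section Atlas

variable {ι : Type w}
variable {A' : ι → Type u} {A : ι → Type v} [∀ α, CommRing (A' α)] [∀ α, CommRing (A α)]
variable {A'₂ : ι → ι → Type u'} {A₂ : ι → ι → Type v'} [∀ α β, CommRing (A'₂ α β)] [∀ α β, CommRing (A₂ α β)]
variable {π : ∀ α, A' α →+* A α} {e : ∀ α, A' α} {π₂ : ∀ α β, A'₂ α β →+* A₂ α β} {e₂ : ∀ α β, A'₂ α β}
variable {ρl : ∀ α β, A' α →+* A'₂ α β} {rl : ∀ α β, A α →+* A₂ α β}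
variable {ρr : ∀ α β, A' β →+* A'₂ α β} {rr : ∀ α β, A β →+* A₂ α β}
variable {I : ∀ α, Ideal (A α)} {I₂ : ∀ α β, Ideal (A₂ α β)}
variable {B' : ι → Type u₃} {B : ι → Type v₃} [∀ α, CommRing (B' α)] [∀ α, CommRing (B α)]
variable {B'₂ : ι → ι → Type u₄} {B₂ : ι → ι → Type v₄} [∀ α β, CommRing (B'₂ α β)] [∀ α β, CommRing (B₂ α β)]
variable {ϖ : ∀ α, B' α →+* B α} {d : ∀ α, B' α} {ϖ₂ : ∀ α β, B'₂ α β →+* B₂ α β} {d₂ : ∀ α β, B'₂ α β}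
variable {σl : ∀ α β, B' α →+* B'₂ α β} {sl : ∀ α β, B α →+* B₂ α β}
variable {σr : ∀ α β, B' β →+* B'₂ α β} {sr : ∀ α β, B β →+* B₂ α β}
variable {J : ∀ α, Ideal (B α)} {J₂ : ∀ α β, Ideal (B₂ α β)}

/-- **A morphism of thickened atlases** `𝔄 → 𝔅` (same index set; charts `π_α : A'_α ↠ A_α`, `ϖ_α : B'_α ↠ B_α`,
subschemes `(I_α)`, `(J_α)`): morphisms of thickenings on the charts `g_α : A'_α → B'_α` over `ḡ_α` and on the
overlaps `g_αβ : A'_αβ → B'_αβ` over `ḡ_αβ`, all carrying flat lifts to flat lifts (`I_α ↦ J_α`, `I_αβ ↦ J_αβ`), and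
COMMUTING WITH THE RESTRICTIONS: `g_αβ ∘ ρˡ_αβ = σˡ_αβ ∘ g_α`, `g_αβ ∘ ρʳ_αβ = σʳ_αβ ∘ g_β`.  Geometrically: a
refinement `V_α ⊆ U_α` of the cover (ring maps go from the coarse charts to the fine ones), chart-wise
localisation, or a change of the overlap trivialisations. [cite: Hartshorne2010, §6 proof of Thm. 6.2 (b)] -/
structure ThickenedAtlasHom (π : ∀ α, A' α →+* A α) (e : ∀ α, A' α) (π₂ : ∀ α β, A'₂ α β →+* A₂ α β)
    (e₂ : ∀ α β, A'₂ α β) (ρl : ∀ α β, A' α →+* A'₂ α β) (ρr : ∀ α β, A' β →+* A'₂ α β)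
    (I : ∀ α, Ideal (A α)) (I₂ : ∀ α β, Ideal (A₂ α β))
    (ϖ : ∀ α, B' α →+* B α) (d : ∀ α, B' α) (ϖ₂ : ∀ α β, B'₂ α β →+* B₂ α β) (d₂ : ∀ α β, B'₂ α β)
    (σl : ∀ α β, B' α →+* B'₂ α β) (σr : ∀ α β, B' β →+* B'₂ α β)
    (J : ∀ α, Ideal (B α)) (J₂ : ∀ α β, Ideal (B₂ α β))
    (g : ∀ α, A' α →+* B' α) (gb : ∀ α, A α →+* B α)
    (g₂ : ∀ α β, A'₂ α β →+* B'₂ α β) (gb₂ : ∀ α β, A₂ α β →+* B₂ α β) : Prop where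
  /-- `g_α` is a morphism of thickenings over `ḡ_α` -/
  hom : ∀ α, IsThickeningHom (π α) (e α) (ϖ α) (d α) (g α) (gb α)
  /-- `g_αβ` is a morphism of thickenings over `ḡ_αβ` -/
  hom₂ : ∀ α β, IsThickeningHom (π₂ α β) (e₂ α β) (ϖ₂ α β) (d₂ α β) (g₂ α β) (gb₂ α β)
  /-- `g_α` carries flat lifts of `I_α` to flat lifts of `J_α` -/
  lifts : ∀ α, PreservesLifts (π α) (e α) (ϖ α) (d α) (g α) (I α) (J α)
  /-- `g_αβ` carries flat lifts of `I_αβ` to flat lifts of `J_αβ` -/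
  lifts₂ : ∀ α β, PreservesLifts (π₂ α β) (e₂ α β) (ϖ₂ α β) (d₂ α β) (g₂ α β) (I₂ α β) (J₂ α β)
  /-- compatibility with the left restrictions: `g_αβ ∘ ρˡ_αβ = σˡ_αβ ∘ g_α` -/
  comml : ∀ α β, (g₂ α β).comp (ρl α β) = (σl α β).comp (g α)
  /-- compatibility with the right restrictions: `g_αβ ∘ ρʳ_αβ = σʳ_αβ ∘ g_β` -/
  commr : ∀ α β, (g₂ α β).comp (ρr α β) = (σr α β).comp (g β)

variable {g : ∀ α, A' α →+* B' α} {gb : ∀ α, A α →+* B α}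
variable {g₂ : ∀ α β, A'₂ α β →+* B'₂ α β} {gb₂ : ∀ α β, A₂ α β →+* B₂ α β}

/-- **A lift of `Z` to `𝔄` pushes forward to a lift of `Z` to `𝔅`**: `(K_α·B'_α)_α` is again a compatible family of
flat lifts (`(K_α B'_α)|_{αβ} = (K_α|_{αβ}) B'_αβ = (K_β|_{αβ}) B'_αβ = (K_β B'_β)|_{αβ}`).
[cite: Hartshorne2010, §6 proof of Thm. 6.2 (b)] -/
theorem IsAtlasLift.map (F : ThickenedAtlasHom π e π₂ e₂ ρl ρr I I₂ ϖ d ϖ₂ d₂ σl σr J J₂ g gb g₂ gb₂)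
    {K : ∀ α, Ideal (A' α)} (hK : IsAtlasLift π e ρl ρr I K) :
    IsAtlasLift ϖ d σl σr J fun α ↦ (K α).map (g α) where
  isLift α := F.lifts α (hK.isLift α)
  compat α β := by
    show ((K α).map (g α)).map (σl α β) = ((K β).map (g β)).map (σr α β)
    rw [Ideal.map_map, Ideal.map_map, ← F.comml, ← F.commr, ← Ideal.map_map, hK.compat α β, Ideal.map_map]

/-- Hence: if `Z` lifts to `𝔄` then `Z` lifts to `𝔅` (e.g. coarse-liftable ⇒ fine-liftable for a refinement).
[cite: Hartshorne2010, §6 proof of Thm. 6.2 (b)] -/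
theorem exists_isAtlasLift_map (F : ThickenedAtlasHom π e π₂ e₂ ρl ρr I I₂ ϖ d ϖ₂ d₂ σl σr J J₂ g gb g₂ gb₂)
    (h : ∃ K : ∀ α, Ideal (A' α), IsAtlasLift π e ρl ρr I K) :
    ∃ L : ∀ α, Ideal (B' α), IsAtlasLift ϖ d σl σr J L := by
  obtain ⟨K, hK⟩ := h
  exact ⟨_, hK.map F⟩

variable {g' : ∀ α, B' α →+* A' α} {gb' : ∀ α, B α →+* A α} {g₂' : ∀ α β, B'₂ α β →+* A'₂ α β}
  {gb₂' : ∀ α β, B₂ α β →+* A₂ α β} in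
/-- With morphisms of thickened atlases in BOTH directions (e.g. an isomorphism of atlases, or two atlases refining
each other) `Z` lifts to `𝔄` iff `Z` lifts to `𝔅`. [cite: Hartshorne2010, §6 proof of Thm. 6.2 (b)] -/
theorem exists_isAtlasLift_iff_of_hom
    (F : ThickenedAtlasHom π e π₂ e₂ ρl ρr I I₂ ϖ d ϖ₂ d₂ σl σr J J₂ g gb g₂ gb₂)
    (G : ThickenedAtlasHom ϖ d ϖ₂ d₂ σl σr J J₂ π e π₂ e₂ ρl ρr I I₂ g' gb' g₂' gb₂') :
    (∃ K : ∀ α, Ideal (A' α), IsAtlasLift π e ρl ρr I K) ↔ ∃ L : ∀ α, Ideal (B' α), IsAtlasLift ϖ d σl σr J L :=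
  ⟨exists_isAtlasLift_map F, exists_isAtlasLift_map G⟩

variable (𝔄 : ThickenedAtlas π e π₂ e₂ ρl rl ρr rr I I₂) (𝔅 : ThickenedAtlas ϖ d ϖ₂ d₂ σl sl σr sr J J₂)
variable (F : ThickenedAtlasHom π e π₂ e₂ ρl ρr I I₂ ϖ d ϖ₂ d₂ σl σr J J₂ g gb g₂ gb₂)
variable {T : ∀ α, Ideal (A' α)} (hT : ∀ α, IsLift (π α) (e α) (I α) (T α))

/-- **NATURALITY OF THE ČECH COCHAIN.**  Push the local choices `T_α` forward to the local choices `T_α·B'_α` of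
`𝔅`; then the Čech cochain of `𝔅` is the RESTRICTION of the Čech cochain of `𝔄` along the overlap maps:
`c^𝔅_αβ = (c^𝔄_αβ)|_{B_αβ}` in `Hom(J_αβ, B_αβ/J_αβ)` (the differences `α_ij` of part (a) are natural, so they are
compatible with refining the cover / changing charts). [cite: Hartshorne2010, §6 proof of Thm. 6.2 (b)] -/
theorem cechCochain_map (α β : ι) :
    resNormal (𝔄.thick₂ α β) (𝔅.thick₂ α β) (F.lifts₂ α β) (𝔄.liftsl α β (hT α)) (cechCochain 𝔄 hT α β) =
      cechCochain 𝔅 (fun γ ↦ F.lifts γ (hT γ)) α β := by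
  rw [cechCochain, cechCochain, ← diff_map_eq_resNormal (𝔄.thick₂ α β) (𝔅.thick₂ α β) (F.hom₂ α β)
    (F.lifts₂ α β) (𝔄.liftsl α β (hT α)) (𝔄.liftsl α β (hT α)) (𝔄.liftsr α β (hT β))]
  exact IsLift.diff_congr (𝔅.thick₂ α β) (F.lifts₂ α β (𝔄.liftsl α β (hT α)))
    (F.lifts₂ α β (𝔄.liftsr α β (hT β))) (𝔅.liftsl α β (F.lifts α (hT α))) (𝔅.liftsr α β (F.lifts β (hT β)))
    (by rw [Ideal.map_map, Ideal.map_map, F.comml]) (by rw [Ideal.map_map, Ideal.map_map, F.commr])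

/-- Restriction to the overlap commutes with the chart maps (left): `(φ|_{A_αβ})|_{B_αβ} = (φ|_{B_α})|_{B_αβ}` — both
are the restriction along `g_αβ ρˡ_αβ = σˡ_αβ g_α`. [cite: Hartshorne2010, §6 proof of Thm. 6.2 (b)] -/
theorem resL_map (α β : ι) (φ : I α →ₗ[A α] A α ⧸ I α) :
    resNormal (𝔄.thick₂ α β) (𝔅.thick₂ α β) (F.lifts₂ α β) (𝔄.liftsl α β (hT α)) (resL 𝔄 hT α β φ) =
      resL 𝔅 (fun γ ↦ F.lifts γ (hT γ)) α β (resNormal (𝔄.thick α) (𝔅.thick α) (F.lifts α) (hT α) φ) := by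
  rw [resL, resL, ← resNormal_comp (𝔄.homl α β) (F.hom₂ α β), ← resNormal_comp (F.hom α) (𝔅.homl α β)]
  exact resNormal_congr_hom (F.comml α β) _ _ (hT α) φ

/-- Restriction to the overlap commutes with the chart maps (right). [cite: Hartshorne2010, §6 proof of Thm. 6.2 (b)] -/
theorem resR_map (α β : ι) (φ : I β →ₗ[A β] A β ⧸ I β) :
    resNormal (𝔄.thick₂ α β) (𝔅.thick₂ α β) (F.lifts₂ α β) (𝔄.liftsr α β (hT β)) (resR 𝔄 hT α β φ) =
      resR 𝔅 (fun γ ↦ F.lifts γ (hT γ)) α β (resNormal (𝔄.thick β) (𝔅.thick β) (F.lifts β) (hT β) φ) := by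
  rw [resR, resR, ← resNormal_comp (𝔄.homr α β) (F.hom₂ α β), ← resNormal_comp (F.hom β) (𝔅.homr α β)]
  exact resNormal_congr_hom (F.commr α β) _ _ (hT β) φ

/-- **THE OBSTRUCTION CLASS IS NATURAL: a coboundary presentation pushes forward.**  If `c^𝔄_αβ = φ_β| − φ_α|`, then
`c^𝔅_αβ = φ'_β| − φ'_α|` with `φ'_α := φ_α|_{B_α}`, the cochains being computed WITH THE PUSHED LOCAL CHOICES
`T_α·B'_α` (stated choice-wise; that the class does not depend on the local choices is `…CechObstruction`'s
`cechCochain_translate`) — so the image of the obstruction class of `𝔄` under the chart maps is the obstruction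
class of `𝔅`. [cite: Hartshorne2010, §6 proof of Thm. 6.2 (b)] -/
theorem coboundary_map {φ : ∀ α, I α →ₗ[A α] A α ⧸ I α}
    (hφ : ∀ α β, cechCochain 𝔄 hT α β = resR 𝔄 hT α β (φ β) - resL 𝔄 hT α β (φ α)) (α β : ι) :
    cechCochain 𝔅 (fun γ ↦ F.lifts γ (hT γ)) α β =
      resR 𝔅 (fun γ ↦ F.lifts γ (hT γ)) α β (resNormal (𝔄.thick β) (𝔅.thick β) (F.lifts β) (hT β) (φ β)) -
        resL 𝔅 (fun γ ↦ F.lifts γ (hT γ)) α β (resNormal (𝔄.thick α) (𝔅.thick α) (F.lifts α) (hT α) (φ α)) := by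
  rw [← resR_map 𝔄 𝔅 F hT, ← resL_map 𝔄 𝔅 F hT,
    resNormal_congr (F.hom₂ α β) (F.lifts₂ α β) (𝔄.liftsl α β (hT α)) (𝔄.liftsr α β (hT β)),
    ← resNormal_sub (F.hom₂ α β) (F.lifts₂ α β), ← hφ, cechCochain_map 𝔄 𝔅 F hT]

/-- The identity morphism of a thickened atlas. [folklore] -/
theorem ThickenedAtlasHom.refl :
    ThickenedAtlasHom π e π₂ e₂ ρl ρr I I₂ π e π₂ e₂ ρl ρr I I₂ (fun α ↦ RingHom.id (A' α))
      (fun α ↦ RingHom.id (A α)) (fun α β ↦ RingHom.id (A'₂ α β)) fun α β ↦ RingHom.id (A₂ α β) where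
  hom α := isThickeningHom_id (π α) (e α)
  hom₂ α β := isThickeningHom_id (π₂ α β) (e₂ α β)
  lifts α := preservesLifts_id (π α) (e α) (I α)
  lifts₂ α β := preservesLifts_id (π₂ α β) (e₂ α β) (I₂ α β)
  comml _ _ := RingHom.ext fun _ ↦ rfl
  commr _ _ := RingHom.ext fun _ ↦ rfl

end Atlas

/-! ### §3 Reindexing an atlas along an index map (refinements) -/

section Reindex

variable {ι : Type w} {κ : Type w'}
variable {A' : ι → Type u} {A : ι → Type v} [∀ α, CommRing (A' α)] [∀ α, CommRing (A α)]
variable {A'₂ : ι → ι → Type u'} {A₂ : ι → ι → Type v'} [∀ α β, CommRing (A'₂ α β)] [∀ α β, CommRing (A₂ α β)]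
variable {π : ∀ α, A' α →+* A α} {e : ∀ α, A' α} {π₂ : ∀ α β, A'₂ α β →+* A₂ α β} {e₂ : ∀ α β, A'₂ α β}
variable {ρl : ∀ α β, A' α →+* A'₂ α β} {rl : ∀ α β, A α →+* A₂ α β}
variable {ρr : ∀ α β, A' β →+* A'₂ α β} {rr : ∀ α β, A β →+* A₂ α β}
variable {I : ∀ α, Ideal (A α)} {I₂ : ∀ α β, Ideal (A₂ α β)}

/-- **Reindexing** a thickened atlas along `f : κ → ι` (the chart of index `a` is the old chart `f a`; a refinement
`(V_a ⊆ U_{f a})_a` is then a morphism FROM the reindexed atlas, §2). [folklore] -/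
theorem ThickenedAtlas.reindex (𝔄 : ThickenedAtlas π e π₂ e₂ ρl rl ρr rr I I₂) (f : κ → ι) :
    ThickenedAtlas (fun a ↦ π (f a)) (fun a ↦ e (f a)) (fun a b ↦ π₂ (f a) (f b)) (fun a b ↦ e₂ (f a) (f b))
      (fun a b ↦ ρl (f a) (f b)) (fun a b ↦ rl (f a) (f b)) (fun a b ↦ ρr (f a) (f b))
      (fun a b ↦ rr (f a) (f b)) (fun a ↦ I (f a)) fun a b ↦ I₂ (f a) (f b) where
  thick a := 𝔄.thick (f a)
  thick₂ a b := 𝔄.thick₂ (f a) (f b)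
  homl a b := 𝔄.homl (f a) (f b)
  homr a b := 𝔄.homr (f a) (f b)
  liftsl a b := 𝔄.liftsl (f a) (f b)
  liftsr a b := 𝔄.liftsr (f a) (f b)

/-- A lift of `Z` to the atlas reindexes. [folklore] -/
theorem IsAtlasLift.reindex {K : ∀ α, Ideal (A' α)} (hK : IsAtlasLift π e ρl ρr I K) (f : κ → ι) :
    IsAtlasLift (fun a ↦ π (f a)) (fun a ↦ e (f a)) (fun a b ↦ ρl (f a) (f b)) (fun a b ↦ ρr (f a) (f b))
      (fun a ↦ I (f a)) fun a ↦ K (f a) where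
  isLift a := hK.isLift (f a)
  compat a b := hK.compat (f a) (f b)

end Reindex

/-! ### §4 Changing the overlap trivialisations does not change the lifts of `Z` -/

section OverlapEquiv

variable {ι : Type w}
variable {A' : ι → Type u} {A : ι → Type v} [∀ α, CommRing (A' α)] [∀ α, CommRing (A α)]
variable {A'₂ : ι → ι → Type u'} {A₂ : ι → ι → Type v'} [∀ α β, CommRing (A'₂ α β)] [∀ α β, CommRing (A₂ α β)]
variable {π : ∀ α, A' α →+* A α} {e : ∀ α, A' α} {π₂ : ∀ α β, A'₂ α β →+* A₂ α β} {e₂ : ∀ α β, A'₂ α β}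
variable {ρl : ∀ α β, A' α →+* A'₂ α β} {rl : ∀ α β, A α →+* A₂ α β}
variable {ρr : ∀ α β, A' β →+* A'₂ α β} {rr : ∀ α β, A β →+* A₂ α β}
variable {I : ∀ α, Ideal (A α)} {I₂ : ∀ α β, Ideal (A₂ α β)}
variable (ψ : ∀ α β, A'₂ α β ≃+* A'₂ α β) (hψ : ∀ α β z, π₂ α β (ψ α β z) = π₂ α β z)
variable (hψe : ∀ α β, ψ α β (e₂ α β) = e₂ α β)

include hψ hψe in
/-- **Re-coordinatising the overlaps.**  Composing both restrictions `ρˡ_αβ`, `ρʳ_αβ` with an automorphism `ψ_αβ` of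
the overlap thickening over the base (`π_αβ ψ_αβ = π_αβ`, `ψ_αβ e_αβ = e_αβ`; e.g. `id + εθ_αβ`) gives again a
thickened atlas (`…Restriction`: `preservesLifts_ringEquiv`). [cite: Hartshorne2010, §6 proof of Thm. 6.2] -/
theorem thickenedAtlas_overlapEquiv (𝔄 : ThickenedAtlas π e π₂ e₂ ρl rl ρr rr I I₂) :
    ThickenedAtlas π e π₂ e₂ (fun α β ↦ (ψ α β : A'₂ α β →+* A'₂ α β).comp (ρl α β)) rl
      (fun α β ↦ (ψ α β : A'₂ α β →+* A'₂ α β).comp (ρr α β)) rr I I₂ where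
  thick := 𝔄.thick
  thick₂ := 𝔄.thick₂
  homl α β :=
    ⟨fun z ↦ by simp only [RingHom.coe_comp, RingHom.coe_coe, Function.comp_apply, hψ, (𝔄.homl α β).comm],
      by simp only [RingHom.coe_comp, RingHom.coe_coe, Function.comp_apply, (𝔄.homl α β).map_eps, hψe]⟩
  homr α β :=
    ⟨fun z ↦ by simp only [RingHom.coe_comp, RingHom.coe_coe, Function.comp_apply, hψ, (𝔄.homr α β).comm],
      by simp only [RingHom.coe_comp, RingHom.coe_coe, Function.comp_apply, (𝔄.homr α β).map_eps, hψe]⟩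
  liftsl α β := (𝔄.liftsl α β).comp (preservesLifts_ringEquiv (ψ α β) (hψ α β) (hψe α β) (I₂ α β))
  liftsr α β := (𝔄.liftsr α β).comp (preservesLifts_ringEquiv (ψ α β) (hψ α β) (hψe α β) (I₂ α β))

/-- **The lifts of `Z` are LITERALLY THE SAME for the re-coordinatised atlas**: `K_α|·ψ = K_β|·ψ ⟺ K_α| = K_β|`
(`ψ_αβ` is bijective) — the obstruction to lifting `Z` does not see a re-coordinatisation of the overlap thickening
(the SAME `ψ_αβ` composed with BOTH restrictions; a twist on one restriction only is a different atlas, cf.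
`…TwistedAtlas`). [folklore] -/
theorem isAtlasLift_overlapEquiv_iff {K : ∀ α, Ideal (A' α)} :
    IsAtlasLift π e (fun α β ↦ (ψ α β : A'₂ α β →+* A'₂ α β).comp (ρl α β))
        (fun α β ↦ (ψ α β : A'₂ α β →+* A'₂ α β).comp (ρr α β)) I K ↔
      IsAtlasLift π e ρl ρr I K := by
  have key : ∀ (α β : ι) (L L' : Ideal (A'₂ α β)),
      L.map (ψ α β : A'₂ α β →+* A'₂ α β) = L'.map (ψ α β : A'₂ α β →+* A'₂ α β) → L = L' := fun α β L L' h ↦ by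
    simpa only [Ideal.map_of_equiv] using congrArg (Ideal.map ((ψ α β).symm : A'₂ α β →+* A'₂ α β)) h
  constructor
  · intro hK
    refine ⟨hK.isLift, fun α β ↦ key α β ((K α).map (ρl α β)) ((K β).map (ρr α β)) ?_⟩
    rw [Ideal.map_map, Ideal.map_map]
    exact hK.compat α β
  · intro hK
    refine ⟨hK.isLift, fun α β ↦ ?_⟩
    show (K α).map ((ψ α β : A'₂ α β →+* A'₂ α β).comp (ρl α β)) =
      (K β).map ((ψ α β : A'₂ α β →+* A'₂ α β).comp (ρr α β))
    rw [← Ideal.map_map, ← Ideal.map_map, hK.compat α β]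

include hψ hψe in
/-- The re-coordinatisation is a morphism of thickened atlases (identity on the charts, `ψ_αβ` on the overlaps),
so `cechCochain_map` / `coboundary_map` apply: the cochain of the re-coordinatised atlas is the restriction of the
old one along `ψ_αβ`. [folklore] -/
theorem thickenedAtlasHom_overlapEquiv :
    ThickenedAtlasHom π e π₂ e₂ ρl ρr I I₂ π e π₂ e₂
      (fun α β ↦ (ψ α β : A'₂ α β →+* A'₂ α β).comp (ρl α β))
      (fun α β ↦ (ψ α β : A'₂ α β →+* A'₂ α β).comp (ρr α β)) I I₂ (fun α ↦ RingHom.id (A' α))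
      (fun α ↦ RingHom.id (A α)) (fun α β ↦ (ψ α β : A'₂ α β →+* A'₂ α β)) fun α β ↦ RingHom.id (A₂ α β) where
  hom α := isThickeningHom_id (π α) (e α)
  hom₂ α β := isThickeningHom_ringEquiv (ψ α β) (hψ α β) (hψe α β)
  lifts α := preservesLifts_id (π α) (e α) (I α)
  lifts₂ α β := preservesLifts_ringEquiv (ψ α β) (hψ α β) (hψe α β) (I₂ α β)
  comml _ _ := RingHom.ext fun _ ↦ rfl
  commr _ _ := RingHom.ext fun _ ↦ rfl

end OverlapEquiv

end EmbeddedDeformation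

end Summit.Ventures.HSemireg
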